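import Summits.QuantumFields.BalabanUV.T4Continuum.Support.B13StepEnvelopeEndSubstrateShift
import Summits.QuantumFields.BalabanUV.T4Continuum.Support.B13StepEndInsOpBalaban
import Summits.QuantumFields.BalabanUV.T4Continuum.Support.SubstrateO1ReadingsShift

/-!
# B13StepEnvelopeEndSubstrateShiftBalaban — NE5 ∕ U3: THE CAUCHY-ENVELOPE END FACE OF RECORD over the measurable operator carrier (E9[rec,sub]),
# STATED AT THE SUBSTRATE's COV-SHIFTED O1 INSTANCE `SubstrateSlotsOfRecordShift.slotsOfRecordShift …` (substrate-p1, W-21; run B's covariance slot ONE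
# LEVEL DEEPER at aligned index `k`, NE5 owner R53 ∕ R54) WITH W1 PRODUCED AT BAŁABAN's TIER-B BACKGROUND — W1 supplied by substrate-p1's W-21b
# `SubstrateO1ReadingsShift` BY NAME, `hc₁ ∕ hθ0 ∕ hθ1` discharged by leaf-10's `B13StepEndInsOpBalaban` (p225077) §1 BY NAME; per two-run object
# (the η-UNIFORM companion is `B13StepEnvelopeEndSubstrateShiftBalabanUniform`)

Cell `pub-balaban`, unit `b2b-balaban-t4-ne5-formalise-leaf-03` (NE5 formalisation swarm, LEAF PROVER 03, gen 16; lineage follower under typer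
`t4/formal/NE5/LEAVES.md` v2.8 CLAIM RULE 1 ∕ 3 ∕ 7 (b); journal INTENT `HOME/CLAIMS.log` l.20304).  THE RE-POINTED TWIN of this lineage's gen-13
`B13StepEnvelopeEndSubstrateBalaban` (p229393).  WHY (owner RULING R53 ∕ located point F-ne5p1-g37-1, l.19772; R54 l.19952; substrate-typer (ν1) l.19999 ∕ T-S19;
R55 l.20143): p229393 re-displays, from substrate-p1's L-E9 face `SubstrateO1Readings` (p225064), the pair `hcovA : ReadsTowerCovA … (rawAOfRecord … (transport U))`
∧ `hcovB : ReadsTowerCovB … (rawBOfRecord …)` at the UNSHIFTED slots, where both runs' `.cov` slots read the SAME depth — a pair jointly inhabitable only by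
level-constant towers (a docstring-level VACUITY flag on p229393 ∕ p229697; nothing landed is false).  The substrate RE-POINTED run B's cov slot one level
deeper (W-21 `rawBOfRecordShift` ∕ `slotsOfRecordShift`, R54 (1) (α) COV-ONLY + rider) and filed the O1 twin W-21b `SubstrateO1ReadingsShift.
weightedEntrywiseRate_slotsOfRecordShift_balaban_ne3Shape` with WINDOWED tower readings `ReadsTowerCovAOn {k : ℕ | k ≤ D.K}` ∕ `ReadsTowerCovBOn …` (owner R55 (R-i), g37-c `B13ReadingsLevelWindow`); R54 (4): the leaf lineages re-point their ENDs — THIS FILE is the E9 road's.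
Imports this lineage's `B13StepEnvelopeEndSubstrateShift` (E9[rec] at the shifted instance, generic `hwer`), leaf-10's `B13StepEndInsOpBalaban` (for
`sqrt_rate_pos_lt_one` ∕ `c1_balaban_nonneg` BY NAME) and substrate-p1's `SubstrateO1ReadingsShift` ONLY; edits nothing; defines NO species reading (R41: W1
is the owner's, its instance the substrate's) and constructs ∕ discharges NOTHING of the instance (R34) beyond the by-name readings listed below.  Letter
names as in p229393 (`D ιr cc ag sg Pm 𝒵 domZ Jc Vv mI Lsl` ∕ `L M a ha o m α β C a′ η` ∕ `𝒞 N dom RgV tow σ dist₁ B₁ δ₁ … Λ₅ hQ hR`).  Summits-side new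
work under the LEAN PLACEMENT RULE (bookkeeping; 0 `def`, 0 cite tags — printed KIND only).
HONEST FRAMING: rung (B)+1 of the FINITE-VOLUME T⁴ continuum programme — NOT infinite volume, NOT a mass gap, NOT the Clay problem, and **NOT A PROOF OF
NE5** (NOT PRINTED: the series prints ε-UNIFORM bounds, never η-RATES; cell GAPS G-t4-U3-1), NOT a proof of NE2 or NE3: every theorem is an IMPLICATION
whose wall binders are DISPLAYED HYPOTHESES — ABOUT THE SUBSTRATE's LETTERS (`SlotLetters`: factor letters, weights `W`, contour systems `ΓA ∕ ΓB`, kernel ∕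
potential tables `dkA … pRB`, insertion letters `ins`, margins `rOp ∕ rHist`) and about node NE3's admissible data — asserted nowhere; among them W2-op
at factor level, `ActOpLineAnalyticOn` of the cores OF THE INSTANCE read through `↥measOp → OpDatum` (GAPS G-ne5p1-1′∕1″, NOT PRINTED), and U1b's
`NE3Shape` (row NE3, OPEN).  The substrate's instance is NOT claimed to satisfy any of them.  W1-cov of record at the shifted slots = rows NE2 ∧ NE3's
TWO-LEVEL tower rate at the related background (R53 (3)) — NOT letter-trivial, NOT zero, asserted by nobody here.  R48 ∕ R49 HONEST LINE: the slots are the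
VALUE-TABLE model (poorer than print at MI-R, [Balaban1988RG2Cluster] Lemma 1 (1.33)); Road D is of record for MI-R; VALUE UNCHANGED.  O-8-shift ∕ O-8-vol ∕
O-8-top (MAP §O1 v0.11) apply to the instance as the substrate states them.  HONEST DEPENDENCY (cell line, verbatim): continuum YM on T⁴ ⇐ BetaPertH ∧
nine spine estimates (0/9 proved); BetaPertH ⇐ (D1) ∧ (D4) ∧ CAP+tail; G-an2-4 gates asym, D1 and NE2/3/4.

WHAT THIS FILE DOES (one composition BY NAME; no analytic estimate of its own).  At `S₀ := slotsOfRecordShift D ιr cc ag sg Pm 𝒵 domZ Jc Vv mI Lsl`, over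
the sub-slot `M := measOp T (…) ι′ Ω 𝒴` (memberships from the six LETTER conditions at the shift — `opA ∕ opB_mem_measOp_slotsOfRecordShift`), four binders
of `B13StepEnvelopeEndSubstrateShift.exists_ne5_of_substrateShift_restrict_envelope_actNormDecay` are READ BY NAME: (i) W1 `hwer` := W-21b's
`weightedEntrywiseRate_slotsOfRecordShift_balaban_ne3Shape` — so U1b's `NE3Shape (minActReadings …) C θ` (OPEN, row NE3), the (3.35)-class ∕ threshold
letters and the owner's O1 reading ∕ decay ∕ Lipschitz ∕ domination letters AT THE SUBSTRATE's SHIFTED TABLES are displayed instead, input rate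
`√(max θ L⁻¹)`; (ii)–(iv) `hc₁ ∕ hθ0 ∕ hθ1` := p225077 §1 (`c1_balaban_nonneg`, `sqrt_rate_pos_lt_one … hNE3.rate_lt_one`).  L01's reading stays the
FACTORISATION DATUM `(iopAt, hiopA)` (`transportReads_slotsOfRecordShift_of_factor`; the insertion datum is unchanged by the shift).  EVERY OTHER binder
is displayed VERBATIM.
* §1 `exists_ne5_of_substrateShift_restrict_envelope_balaban_ne3Shape` — PER TWO-RUN OBJECT `D : DrivenRuns 𝔾` and letter package `Lsl`: conclusion
  LITERALLY `∃ C₅, T4OutputRate.NE5 (B13StepOfRecord.outA (slotsOfRecordShift …) E₀ cB) (B13StepOfRecord.outB (slotsOfRecordShift …) E₀ cB) W κ θ′ C₅` at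
  the PRESCRIBED `θ′`.
CENSUS vs p229393 §1 (binders, by name): IDENTICAL list; the ONLY changes are the instance (`slotsOfRecord ↦ slotsOfRecordShift` in every slot-bearing
binder and in the conclusion), run B's raw record (`rawBOfRecord ιr D … ↦ rawBOfRecordShift D ιr …` in `hcovB ∕ hΔB ∕ hΓB ∕ hQ ∕ hR ∕ hbdB`) and the
SHAPE of the two tower readings `hcovA ∕ hcovB` (whatever W-21b displays — here WINDOWED tower readings `ReadsTowerCovAOn {k : ℕ | k ≤ D.K}` ∕ `ReadsTowerCovBOn …` (owner R55 (R-i), g37-c `B13ReadingsLevelWindow`)).  So at the shifted instance the terminal E9 face displays ONLY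
`NE3Shape` + class ∕ threshold + O1 letters at the substrate's shifted tables + the six letter conditions + factorisation datum + W3 slice budgets + L05 ∕
L06 + `RawBounded` ×2 + floor + W4 `InsertionRate` + rooms + the activity-norm majorant with decay split ∕ anchored norm (`0 ≤ Φ′`, `36Φ′ < 1`) +
**`ActOpLineAnalyticOn`** + `ActExpLinearOn` over `↥measOp` + signs + `√(max θ L⁻¹) ≤ θ′ ≤ 1`, `0 < ω < 1` and the TWO STRICT SIZE INEQUALITIES
`cA(EA₀ + E₀) < 1 − ω`, `ω + (Φ′∕(1 − 36Φ′))·cA·(1 − ω)∕(1 − ω − cA(EA₀ + E₀)) < θ′` — no `hwer`, no rate binder, no `ρ₀ ∕ k₀ ∕ B`, no slot line,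
no `TransportReads`, no chart.  NOT decided here: whether Bałaban's constants satisfy the two inequalities (leaf-10's `B13SmallnessCensus.md`).  Headline
wording (trigger c5 ∕ referee INFO-38): «END ⇐ instance letters», never «leaf instantiated»; 0∕12 leaves on Bałaban's concrete objects (O1 = substrate
cell); spine 0∕9.  `FlowStep.BetaPertH`, (B), (B^μ) do not occur.  0 sorry; axioms ⊆ {propext, Classical.choice, Quot.sound}.
-/


noncomputable section

open scoped BigOperators Matrix.Norms.L2Operator
open Metric Set

namespace Summit.QuantumFields.BalabanUV.T4Continuum.B13StepEnvelopeEndSubstrateShiftBalaban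

open _root_.MeasureTheory
open Literature.MathematicalPhysics.QuantumFieldTheory.Balaban1983to89
open Literature.MathematicalPhysics.QuantumFieldTheory.Balaban1983to89.T4OutputRate (DecayBound NE5)
open Literature.MathematicalPhysics.QuantumFieldTheory.Balaban1983to89.T4InputCauchyRateSpecies (ballClass)
open Literature.MathematicalPhysics.QuantumFieldTheory.Balaban1983to89.B5Prop11Plancherel (Cst Tor fine)
open Literature.MathematicalPhysics.QuantumFieldTheory.Balaban1983to89.B5G183RateUnitTower (lev lev_neZero)
open Literature.MathematicalPhysics.QuantumFieldTheory.Balaban1983to89.T4EtaRateMin (NE3Shape)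
open Summit.QuantumFields.BalabanUV.T4Continuum
open Summit.QuantumFields.BalabanUV.T4Continuum.B13Carriers (TwoRuns)
open Summit.QuantumFields.BalabanUV.T4Continuum.B13OpDatum (OpDatum Species FormatBounded)
open Summit.QuantumFields.BalabanUV.T4Continuum.B13OpDatumJunctions (opOf RawBounded WeightedEntrywiseRate)
open Summit.QuantumFields.BalabanUV.T4Continuum.B13OpMeasurable (measOp)
open Summit.QuantumFields.BalabanUV.T4Continuum.B13HistMeasurable (MeasPotFrame B13HistM)
open Summit.QuantumFields.BalabanUV.T4Continuum.B13StepTermLabels (TermIdx InnerLabel)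
open Summit.QuantumFields.BalabanUV.T4Continuum.B13StepTermFamily (ActData ActExpLinearOn)
open Summit.QuantumFields.BalabanUV.T4Continuum.B13StepTermSocket (labelsIndexing)
open Summit.QuantumFields.BalabanUV.T4Continuum.B13InnerData (Bnd b13InnerData)
open Summit.QuantumFields.BalabanUV.T4Continuum.UrsellTreeSum (ind)
open Summit.QuantumFields.BalabanUV.T4Continuum.UrsellTermBudget (actSum)
open Summit.QuantumFields.BalabanUV.T4Continuum.B13DomainGeometryTR (SCube footprint domainGeometry)
open Summit.QuantumFields.BalabanUV.T4Continuum.B13Base (selfCtr)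
open Summit.QuantumFields.BalabanUV.T4Continuum.B13StepOfRecord (Slots assembly step outA outB)
open Summit.QuantumFields.BalabanUV.T4Continuum.B13StepOfRecordSub (assemblyOn restrict)
open Summit.QuantumFields.BalabanUV.T4Continuum.B13TermOpEnvelope (ActOpLineAnalyticOn)
open Summit.QuantumFields.BalabanUV.T4Continuum.B13StepEnvelopeEndSubstrateShift (exists_ne5_of_substrateShift_restrict_envelope_actNormDecay)
open Summit.QuantumFields.BalabanUV.T4Continuum.B13StepEndInsOpBalaban (sqrt_rate_pos_lt_one c1_balaban_nonneg)
open Summit.QuantumFields.BalabanUV.T4Continuum.B13StepOfRecordSubstrateShiftLetters (opA_mem_measOp_slotsOfRecordShift opB_mem_measOp_slotsOfRecordShift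
  transportReads_slotsOfRecordShift_of_factor)
open Summit.QuantumFields.BalabanUV.T4Continuum.B13ReadingsDecay (CovWeightDominatesDist)
open Summit.QuantumFields.BalabanUV.T4Continuum.B13ReadingsLevelWindow (ReadsTowerCovAOn ReadsTowerCovBOn)
open Summit.QuantumFields.BalabanUV.T4Continuum.B13ReadingsImage
open Summit.QuantumFields.BalabanUV.T4Continuum.B13ReadingsLocal (PotQLipschitzReading PotRLipschitzReading)
open Summit.QuantumFields.BalabanUV.T4Continuum.B13ReadingsAssembly (CpertRec)
open Summit.QuantumFields.BalabanUV.T4Continuum.SubstrateO1ReadingsShift (weightedEntrywiseRate_slotsOfRecordShift_balaban_ne3Shape)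
open Summit.QuantumFields.BalabanUV.T4Continuum.DecayRateInterpolation (EntryDecay)
open Summit.QuantumFields.BalabanUV.T4Continuum.SubstrateBackgroundTransporters (unitMod)
open Summit.QuantumFields.BalabanUV.T4Continuum.SubstrateTwoRunsDriven (DrivenRuns)
open Summit.QuantumFields.BalabanUV.T4Continuum.SubstrateRawSpecies (rawAOfRecord)
open Summit.QuantumFields.BalabanUV.T4Continuum.SubstrateSlotsOfRecord (SpeciesRec SlotLetters slotsOfRecord)
open Summit.QuantumFields.BalabanUV.T4Continuum.SubstrateSlotsOfRecordShift (rawBOfRecordShift slotsOfRecordShift)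
open Summit.QuantumFields.BalabanUV.T4Continuum.BalabanAveragedTowerUnit (idx)
open Summit.QuantumFields.BalabanUV.T4Continuum.GaugeTermScalarData (QuT Q1)
open Summit.QuantumFields.BalabanUV.T4Continuum.RegularSiteTransporters (siteT)
open Summit.QuantumFields.BalabanUV.T4Continuum.RegularBackgroundTower (RegularTransporters)
open Summit.QuantumFields.BalabanUV.T4Continuum.NE2ColourPerturbedLayer (pertCovC)
open Summit.QuantumFields.BalabanUV.T4Continuum.NE2BalabanRoot (balabanPert)
open Summit.QuantumFields.BalabanUV.T4Continuum.NE2BalabanGauge (gaugeSlot liftR)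
open Summit.QuantumFields.BalabanUV.T4Continuum.NE2BalabanThreshold (etaStar)
open Summit.QuantumFields.BalabanUV.T4Continuum.NE2FromNE3Carrier (ne2Loc)
open Summit.QuantumFields.BalabanUV.T4Continuum.MinimalActionRate (minActReadings)

/-! ## §1 E9[rec,sub] of record at Bałaban's tier-B background, STATED AT THE SUBSTRATE's COV-SHIFTED O1 INSTANCE -/

section Instance

-- the substrate's telescope for `slotsOfRecordShift` (W-21; = `slotsOfRecord`'s, p220104 §SlotsRecord; letter names as in `SubstrateO1ReadingsShift`)
variable {𝔾 : Type} [GaugeGroup 𝔾] (D : DrivenRuns 𝔾)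
variable {oc : Type} [Fintype oc] [DecidableEq oc] (ιr : 𝔾 →* Matrix oc oc ℂ) (cc : ℂ) (ag : ℝ) (sg : ℕ → ℂ)
variable {T ι' Sy Ω 𝒴 : Type} [MeasurableSpace Ω] (Pm : MeasPotFrame D.carriers) {IOp : Type*}
  (𝒵 : D.carriers.Dom → InnerLabel D.carriers.Dom (Bnd D.toTwoRuns) → Type) [∀ Z j, Fintype (𝒵 Z j)] (domZ : ∀ Z j, 𝒵 Z j → D.carriers.Dom)
  (Jc : D.carriers.Dom → InnerLabel D.carriers.Dom (Bnd D.toTwoRuns) → Type) [∀ Z j, Fintype (Jc Z j)]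
  (Vv : D.carriers.Dom → InnerLabel D.carriers.Dom (Bnd D.toTwoRuns) → Type) [∀ Z j, NormedAddCommGroup (Vv Z j)]
  [∀ Z j, InnerProductSpace ℝ (Vv Z j)] [∀ Z j, MeasurableSpace (Vv Z j)] [∀ Z j, BorelSpace (Vv Z j)] [∀ Z j, FiniteDimensional ℝ (Vv Z j)]
  (mI : D.carriers.Dom → InnerLabel D.carriers.Dom (Bnd D.toTwoRuns) → Type) [∀ Z j, Fintype (mI Z j)] [∀ Z j, DecidableEq (mI Z j)]
  (Lsl : SlotLetters D (o := oc) (T := T) (ι' := ι') (S := Sy) (Ω := Ω) (𝒴 := 𝒴) Pm (IOp := IOp) 𝒵 domZ Jc Vv mI)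
-- node NE3 ∕ the owner's letters (sizes)
variable {d : ℕ} (L : ℕ) [NeZero L] (M : Fin d → ℕ) [hM : ∀ μ, NeZero (M μ)] (a : ℝ) (ha : 0 < a)
variable {o : Type*} [Fintype o] [DecidableEq o] {α β C a' η : ℝ} {m : Type*} [Fintype m] [DecidableEq m]
-- the measurable sort of the `ActExpLinearOn` datum (as in p222736)
variable {Ω' : Type*} [MeasurableSpace Ω']

/-- [folklore] **THE CAUCHY-ENVELOPE END OF RECORD OVER THE MEASURABLE OPERATOR CARRIER, W1 PRODUCED AT BAŁABAN's TIER-B BACKGROUND, ARITHMETIC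
LETTERS ELIMINATED — AT THE SUBSTRATE's COV-SHIFTED O1 INSTANCE** `S₀ := slotsOfRecordShift D ιr cc ag sg Pm 𝒵 domZ Jc Vv mI Lsl` (W-21), `M := measOp T (…)
ι′ Ω 𝒴`: this lineage's `B13StepEnvelopeEndSubstrateShift.exists_ne5_of_substrateShift_restrict_envelope_actNormDecay` with `hwer` SUPPLIED BY NAME by
substrate-p1's W-21b `weightedEntrywiseRate_slotsOfRecordShift_balaban_ne3Shape` (so U1b's `NE3Shape` (OPEN), the class ∕ threshold letters `hreg hα hβ hC
ha' hαη hβη hη` and the owner's O1 letters AT THE SUBSTRATE's SHIFTED TABLES `hdec₁ … hR` are displayed instead — run A read THROUGH THE TRANSPORTER, run B's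
covariance ONE LEVEL DEEPER (`rawBOfRecordShift`), WINDOWED tower readings `ReadsTowerCovAOn {k : ℕ | k ≤ D.K}` ∕ `ReadsTowerCovBOn …` (owner R55 (R-i), g37-c `B13ReadingsLevelWindow`)), `hc₁ ∕ hθ0 ∕ hθ1` discharged (p225077 §1); the six
LETTER conditions at the shift, the factorisation datum `(iopAt, hiopA)` and EVERY OTHER binder of the parent VERBATIM, at input rate `√(max θ L⁻¹)`.
Conclusion LITERALLY `∃ C₅, T4OutputRate.NE5 (B13StepOfRecord.outA (slotsOfRecordShift …) E₀ cB) (B13StepOfRecord.outB (slotsOfRecordShift …) E₀ cB) W κ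
θ′ C₅` at the PRESCRIBED `θ′`.  NOT a proof of NE5 ∕ NE2 ∕ NE3: an implication from displayed binders about the substrate's letters and node NE3's
admissible data (W2-op `ActOpLineAnalyticOn` over `↥measOp` among them); nothing of Bałaban's is asserted. -/
theorem exists_ne5_of_substrateShift_restrict_envelope_balaban_ne3Shape (E₀ cB : ℝ)
    {𝒞 : ℕ → Set (B7Prop1Explicit.Site d → Fin d → (Matrix o o ℂ)ˣ)} {N : ℕ}
    {dom : Set (B7Prop1Explicit.Site d → Fin d → (Matrix o o ℂ)ˣ)} (hL : 2 ≤ L) (hd : 1 ≤ d)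
    {RgV : (B7Prop1Explicit.Site d → Fin d → (Matrix o o ℂ)ˣ) → ((k : ℕ) → Fin d → (Tor (fine (lev L k) M) → Matrix o o ℂ))}
    (hreg : ∀ V ∈ dom, RegularTransporters L M (liftR L M (RgV V)) α β) (hα : 0 ≤ α) (hβ : 0 ≤ β) (hC : 0 ≤ C) {θ : ℝ}
    (hNE3 : NE3Shape (minActReadings d 𝒞 L N dom (ne2Loc L M fun V => liftR L M (RgV V))) C θ)
    (ha' : 0 < a') (hαη : α ≤ η) (hβη : β ≤ η) (hη : η ≤ etaStar o d a a')
    -- the towers over the two-run object's run-B backgrounds and the window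
    {tow : ℕ → (ℕ → ℝ) → D.toTwoRuns.carriers.BgB → ↥dom} {W : Set (ℕ → ℝ)}
    -- the covariance species, read at the substrate's V1 operator entries
    {σ : T → ((Tor (unitMod (D.F.P D.K)) × Fin (D.F.P D.K).d) × oc) → idx L M 0 × o} {dist₁ : idx L M 0 × o → idx L M 0 × o → ℝ} {B₁ δ₁ : ℝ}
    (hdec₁ : ∀ V ∈ dom, ∀ k, EntryDecay dist₁
      (pertCovC L M a ha (balabanPert L M a (liftR L M (RgV V)) (gaugeSlot L M (RgV V) (QuT L M o (siteT L M (RgV V))) (Q1 L M o) a'))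
        1 k) B₁ δ₁)
    (hcovA : ReadsTowerCovAOn {k : ℕ | k ≤ D.K}
      (fun V : ↥dom => pertCovC L M a ha
        (balabanPert L M a (liftR L M (RgV V)) (gaugeSlot L M (RgV V) (QuT L M o (siteT L M (RgV V))) (Q1 L M o) a')) 1)
      σ tow (fun g U k => (rawAOfRecord ιr D cc ag sg Lsl.ΓA Lsl.dkA Lsl.gcA Lsl.pQA Lsl.pRA) g (D.toTwoRuns.carriers.transport U) k) W)
    (hcovB : ReadsTowerCovBOn {k : ℕ | k ≤ D.K}
      (fun V : ↥dom => pertCovC L M a ha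
        (balabanPert L M a (liftR L M (RgV V)) (gaugeSlot L M (RgV V) (QuT L M o (siteT L M (RgV V))) (Q1 L M o) a')) 1)
      σ tow (rawBOfRecordShift D ιr cc ag sg Lsl.ΓB Lsl.dkB Lsl.gcB Lsl.pQB Lsl.pRB) W)
    (hdom₁ : CovWeightDominatesDist (slotsOfRecordShift D ιr cc ag sg Pm 𝒵 domZ Jc Vv mI Lsl).F dist₁ σ (δ₁ / 2))
    -- the `deltaKer` species
    {S₂ : Set (Matrix (idx L M 0 × o) (idx L M 0 × o) ℂ)} {Φ : T → Matrix (idx L M 0 × o) (idx L M 0 × o) ℂ → Matrix m m ℂ}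
    {Λ₂ : ℝ} (hΦ : ∀ t, OpLipschitzOn S₂ (Φ t) Λ₂) (hΛ₂ : 0 ≤ Λ₂)
    (hS₂ : ∀ V ∈ dom, ∀ k, pertCovC L M a ha
      (balabanPert L M a (liftR L M (RgV V)) (gaugeSlot L M (RgV V) (QuT L M o (siteT L M (RgV V))) (Q1 L M o) a')) 1 k ∈ S₂)
    {dist₂ : m → m → ℝ} {B₂ δ₂ : ℝ}
    (hdecΦ : ∀ V ∈ dom, ∀ t k, EntryDecay dist₂ (Φ t (pertCovC L M a ha
      (balabanPert L M a (liftR L M (RgV V)) (gaugeSlot L M (RgV V) (QuT L M o (siteT L M (RgV V))) (Q1 L M o) a')) 1 k)) B₂ δ₂)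
    {σX : T → ι' → m}
    (hΔA : ReadsTowerDeltaA (fun (V : ↥dom) t k => Φ t (pertCovC L M a ha
      (balabanPert L M a (liftR L M (RgV V)) (gaugeSlot L M (RgV V) (QuT L M o (siteT L M (RgV V))) (Q1 L M o) a')) 1 k))
      σX tow (fun g U k => (rawAOfRecord ιr D cc ag sg Lsl.ΓA Lsl.dkA Lsl.gcA Lsl.pQA Lsl.pRA) g (D.toTwoRuns.carriers.transport U) k) W)
    (hΔB : ReadsTowerDeltaB (fun (V : ↥dom) t k => Φ t (pertCovC L M a ha
      (balabanPert L M a (liftR L M (RgV V)) (gaugeSlot L M (RgV V) (QuT L M o (siteT L M (RgV V))) (Q1 L M o) a')) 1 k))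
      σX tow (rawBOfRecordShift D ιr cc ag sg Lsl.ΓB Lsl.dkB Lsl.gcB Lsl.pQB Lsl.pRB) W)
    (hdom₂ : DeltaWeightDominatesDist (slotsOfRecordShift D ιr cc ag sg Pm 𝒵 domZ Jc Vv mI Lsl).F dist₂ σX (δ₂ / 2))
    -- the `gammaConstituent` species
    {S₃ : Set (Matrix (idx L M 0 × o) (idx L M 0 × o) ℂ)} {Ψ : T → Matrix (idx L M 0 × o) (idx L M 0 × o) ℂ → Matrix m m ℂ}
    {Λ₃ : ℝ} (hΨ : ∀ t, OpLipschitzOn S₃ (Ψ t) Λ₃) (hΛ₃ : 0 ≤ Λ₃)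
    (hS₃ : ∀ V ∈ dom, ∀ k, pertCovC L M a ha
      (balabanPert L M a (liftR L M (RgV V)) (gaugeSlot L M (RgV V) (QuT L M o (siteT L M (RgV V))) (Q1 L M o) a')) 1 k ∈ S₃)
    {dist₃ : m → m → ℝ} {B₃ δ₃ : ℝ}
    (hdecΨ : ∀ V ∈ dom, ∀ t k, EntryDecay dist₃ (Ψ t (pertCovC L M a ha
      (balabanPert L M a (liftR L M (RgV V)) (gaugeSlot L M (RgV V) (QuT L M o (siteT L M (RgV V))) (Q1 L M o) a')) 1 k)) B₃ δ₃)
    {σB : T → ((Tor (unitMod (D.F.P D.K)) × Fin (D.F.P D.K).d) × oc) → m}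
    (hΓA : ReadsTowerGammaA (fun (V : ↥dom) t k => Ψ t (pertCovC L M a ha
      (balabanPert L M a (liftR L M (RgV V)) (gaugeSlot L M (RgV V) (QuT L M o (siteT L M (RgV V))) (Q1 L M o) a')) 1 k))
      σB σX tow (fun g U k => (rawAOfRecord ιr D cc ag sg Lsl.ΓA Lsl.dkA Lsl.gcA Lsl.pQA Lsl.pRA) g (D.toTwoRuns.carriers.transport U) k) W)
    (hΓB : ReadsTowerGammaB (fun (V : ↥dom) t k => Ψ t (pertCovC L M a ha
      (balabanPert L M a (liftR L M (RgV V)) (gaugeSlot L M (RgV V) (QuT L M o (siteT L M (RgV V))) (Q1 L M o) a')) 1 k))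
      σB σX tow (rawBOfRecordShift D ιr cc ag sg Lsl.ΓB Lsl.dkB Lsl.gcB Lsl.pQB Lsl.pRB) W)
    (hdom₃ : GammaWeightDominatesDist (slotsOfRecordShift D ιr cc ag sg Pm 𝒵 domZ Jc Vv mI Lsl).F dist₃ σB σX (δ₃ / 2))
    -- the potential species
    {Λ₄ Λ₅ : ℝ} (hΛ₄ : 0 ≤ Λ₄) (hΛ₅ : 0 ≤ Λ₅)
    (hQ : PotQLipschitzReading (minActReadings d 𝒞 L N dom (ne2Loc L M fun V => liftR L M (RgV V))) (slotsOfRecordShift D ιr cc ag sg Pm 𝒵 domZ Jc Vv mI Lsl).F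
      (fun g U k => (rawAOfRecord ιr D cc ag sg Lsl.ΓA Lsl.dkA Lsl.gcA Lsl.pQA Lsl.pRA) g (D.toTwoRuns.carriers.transport U) k)
      (rawBOfRecordShift D ιr cc ag sg Lsl.ΓB Lsl.dkB Lsl.gcB Lsl.pQB Lsl.pRB) W Λ₄)
    (hR : PotRLipschitzReading (minActReadings d 𝒞 L N dom (ne2Loc L M fun V => liftR L M (RgV V))) (slotsOfRecordShift D ιr cc ag sg Pm 𝒵 domZ Jc Vv mI Lsl).F
      (fun g U k => (rawAOfRecord ιr D cc ag sg Lsl.ΓA Lsl.dkA Lsl.gcA Lsl.pQA Lsl.pRA) g (D.toTwoRuns.carriers.transport U) k)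
      (rawBOfRecordShift D ιr cc ag sg Lsl.ΓB Lsl.dkB Lsl.gcB Lsl.pQB Lsl.pRB) W Λ₅)
    -- leaf-01-g11's six LETTER conditions (replace `hMA` ∕ `hMB`; p221190 §1)
    (hbdA : ∀ (g : ℕ → ℝ) (U : D.carriers.BgA) (k : ℕ),
      FormatBounded (Lsl.W k).format (rawAOfRecord ιr D cc ag sg Lsl.ΓA Lsl.dkA Lsl.gcA Lsl.pQA Lsl.pRA g U k).kernel)
    (hmQA : ∀ (r : ℝ) (U : GaugeField (D.F.P D.K) 0 𝔾) (k : ℕ) (Y : 𝒴) (b b' : ((Tor (unitMod (D.F.P D.K)) × Fin (D.F.P D.K).d) × oc)),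
        Measurable fun x : Ω => Lsl.pQA r U k x Y b b')
    (hmRA : ∀ (r : ℝ) (U : GaugeField (D.F.P D.K) 0 𝔾) (k : ℕ) (Y : 𝒴), Measurable fun x : Ω => Lsl.pRA r U k x Y)
    (hbdB : ∀ (g : ℕ → ℝ) (U : D.carriers.BgB) (k : ℕ),
      FormatBounded (Lsl.W k).format (rawBOfRecordShift D ιr cc ag sg Lsl.ΓB Lsl.dkB Lsl.gcB Lsl.pQB Lsl.pRB g U k).kernel)
    (hmQB : ∀ (r : ℝ) (U : GaugeField (D.F.P (D.K + 1)) 0 𝔾) (k : ℕ) (Y : 𝒴) (b b' : ((Tor (unitMod (D.F.P D.K)) × Fin (D.F.P D.K).d) × oc)),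
        Measurable fun x : Ω => Lsl.pQB r U k x Y b b')
    (hmRB : ∀ (r : ℝ) (U : GaugeField (D.F.P (D.K + 1)) 0 𝔾) (k : ℕ) (Y : 𝒴), Measurable fun x : Ω => Lsl.pRB r U k x Y)
    -- leaf-01-g11's factorisation datum (replaces the L01 reading `hT`; p221190 §2)
    (iopAt : ℝ → D.carriers.BgA → ℕ → IOp)
    (hiopA : ∀ (r : ℝ) (U : D.carriers.BgB) (k : ℕ), Lsl.ins.iopA r U k = iopAt r (D.carriers.transport U) k)
    -- the rest of E9[rec,sub] at the instance, BY NAME from p222736 §2 (VERBATIM; anchored-norm bound renamed `hΦ'`)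
    {ROp RHist : ℕ → ℝ}
    {A A' : ℕ → (ℕ → ℝ) → D.toTwoRuns.carriers.BgB → D.toTwoRuns.carriers.Dom → InnerLabel D.toTwoRuns.carriers.Dom (Bnd D.toTwoRuns) → ℝ}
    {Dt : ActData D.toTwoRuns.carriers.Dom (InnerLabel D.toTwoRuns.carriers.Dom (Bnd D.toTwoRuns)) (measOp T ((Tor (unitMod (D.F.P D.K)) × Fin (D.F.P D.K).d) × oc) ι' Ω 𝒴) (B13HistM Pm) Ω'}
    {κ Φ' EA₀ cA r₀ δ' θ' : ℝ}
    (hbB : (assembly (slotsOfRecordShift D ιr cc ag sg Pm 𝒵 domZ Jc Vv mI Lsl)).SliceBudgetB W κ cB)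
    (hbA : (slotsOfRecordShift D ιr cc ag sg Pm 𝒵 domZ Jc Vv mI Lsl).D.SliceBudget (step (slotsOfRecordShift D ιr cc ag sg Pm 𝒵 domZ Jc Vv mI Lsl) E₀ cB) W κ cA)
    (hdA : DecayBound (B13StepOfRecord.outA (slotsOfRecordShift D ιr cc ag sg Pm 𝒵 domZ Jc Vv mI Lsl) E₀ cB) W EA₀ κ)
    (hdB : DecayBound (B13StepOfRecord.outB (slotsOfRecordShift D ιr cc ag sg Pm 𝒵 domZ Jc Vv mI Lsl) E₀ cB) W E₀ κ)
    (hRA : RawBounded (slotsOfRecordShift D ιr cc ag sg Pm 𝒵 domZ Jc Vv mI Lsl).F (assembly (slotsOfRecordShift D ιr cc ag sg Pm 𝒵 domZ Jc Vv mI Lsl)).rawAt W)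
    (hRB : RawBounded (slotsOfRecordShift D ιr cc ag sg Pm 𝒵 domZ Jc Vv mI Lsl).F (slotsOfRecordShift D ιr cc ag sg Pm 𝒵 domZ Jc Vv mI Lsl).rawB W)
    (hfl : ∀ k, r₀ ≤ Lsl.rOp k)
    (hins : (step (slotsOfRecordShift D ιr cc ag sg Pm 𝒵 domZ Jc Vv mI Lsl) E₀ cB).InsertionRate W κ E₀ δ' (Real.sqrt (max θ ((L : ℝ)⁻¹))))
    (hOp : ∀ k, Lsl.rOp k ≤ ROp k) (hHist : ∀ k, (assembly (slotsOfRecordShift D ιr cc ag sg Pm 𝒵 domZ Jc Vv mI Lsl)).bHist E₀ cB k + Lsl.rHist k ≤ RHist k)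
    (hA : ∀ k, ∀ g ∈ W, ∀ (U : D.toTwoRuns.carriers.BgB) (q : (measOp T ((Tor (unitMod (D.F.P D.K)) × Fin (D.F.P D.K).d) × oc) ι' Ω 𝒴) × B13HistM Pm),
      q ∈ (ballClass (selfCtr (assemblyOn (restrict (slotsOfRecordShift D ιr cc ag sg Pm 𝒵 domZ Jc Vv mI Lsl) (measOp T ((Tor (unitMod (D.F.P D.K)) × Fin (D.F.P D.K).d) × oc) ι' Ω 𝒴)
          (opA_mem_measOp_slotsOfRecordShift D ιr cc ag sg Pm 𝒵 domZ Jc Vv mI Lsl hbdA hmQA hmRA)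
          (opB_mem_measOp_slotsOfRecordShift D ιr cc ag sg Pm 𝒵 domZ Jc Vv mI Lsl hbdB hmQB hmRB))).raw
        (assemblyOn (restrict (slotsOfRecordShift D ιr cc ag sg Pm 𝒵 domZ Jc Vv mI Lsl) (measOp T ((Tor (unitMod (D.F.P D.K)) × Fin (D.F.P D.K).d) × oc) ι' Ω 𝒴)
          (opA_mem_measOp_slotsOfRecordShift D ιr cc ag sg Pm 𝒵 domZ Jc Vv mI Lsl hbdA hmQA hmRA)
          (opB_mem_measOp_slotsOfRecordShift D ιr cc ag sg Pm 𝒵 domZ Jc Vv mI Lsl hbdB hmQB hmRB))).histRef) ROp RHist) k g U →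
        ∀ X : D.toTwoRuns.carriers.Dom, D.toTwoRuns.carriers.scale X = k → ∀ i : TermIdx D.toTwoRuns.carriers.Dom (Bnd D.toTwoRuns),
          (labelsIndexing (domainGeometry D.toTwoRuns) (b13InnerData D.toTwoRuns)).Rel k i X → ∀ m,
            ‖(slotsOfRecordShift D ιr cc ag sg Pm 𝒵 domZ Jc Vv mI Lsl).act ((labelsIndexing (domainGeometry D.toTwoRuns) (b13InnerData D.toTwoRuns)).poly i m) ((labelsIndexing (domainGeometry D.toTwoRuns) (b13InnerData D.toTwoRuns)).lab i m) (q.1 : OpDatum (SpeciesRec D oc T ι' Ω 𝒴)) q.2‖ ≤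
              A k g U ((labelsIndexing (domainGeometry D.toTwoRuns) (b13InnerData D.toTwoRuns)).poly i m) ((labelsIndexing (domainGeometry D.toTwoRuns) (b13InnerData D.toTwoRuns)).lab i m))
    (hA0 : ∀ k g U Z ℓ, 0 ≤ A k g U Z ℓ) (hA0' : ∀ k g U Z ℓ, 0 ≤ A' k g U Z ℓ) (hκ : 0 ≤ κ)
    (hdec : ∀ k g U Z ℓ, A k g U Z ℓ ≤ A' k g U Z ℓ * Real.exp (-(κ * (D.toTwoRuns.carriers.d Z + 5))))
    (hΦ0 : 0 ≤ Φ') (hΦsmall : 36 * Φ' < 1)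
    (hΦ' : ∀ k, ∀ g ∈ W, ∀ (U : D.toTwoRuns.carriers.BgB) (q : SCube D.toTwoRuns),
      ∑ Z ∈ D.toTwoRuns.domAt k, ind (q ∈ footprint Z) * actSum (b13InnerData D.toTwoRuns) (A' k g U) k Z *
        Real.exp ((footprint Z).card) ≤ Φ')
    (hact : ActOpLineAnalyticOn (labelsIndexing (domainGeometry D.toTwoRuns) (b13InnerData D.toTwoRuns)) (restrict (slotsOfRecordShift D ιr cc ag sg Pm 𝒵 domZ Jc Vv mI Lsl) (measOp T ((Tor (unitMod (D.F.P D.K)) × Fin (D.F.P D.K).d) × oc) ι' Ω 𝒴)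
          (opA_mem_measOp_slotsOfRecordShift D ιr cc ag sg Pm 𝒵 domZ Jc Vv mI Lsl hbdA hmQA hmRA)
          (opB_mem_measOp_slotsOfRecordShift D ιr cc ag sg Pm 𝒵 domZ Jc Vv mI Lsl hbdB hmQB hmRB)).act
      (ballClass (selfCtr (assemblyOn (restrict (slotsOfRecordShift D ιr cc ag sg Pm 𝒵 domZ Jc Vv mI Lsl) (measOp T ((Tor (unitMod (D.F.P D.K)) × Fin (D.F.P D.K).d) × oc) ι' Ω 𝒴)
          (opA_mem_measOp_slotsOfRecordShift D ιr cc ag sg Pm 𝒵 domZ Jc Vv mI Lsl hbdA hmQA hmRA)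
          (opB_mem_measOp_slotsOfRecordShift D ιr cc ag sg Pm 𝒵 domZ Jc Vv mI Lsl hbdB hmQB hmRB))).raw
        (assemblyOn (restrict (slotsOfRecordShift D ιr cc ag sg Pm 𝒵 domZ Jc Vv mI Lsl) (measOp T ((Tor (unitMod (D.F.P D.K)) × Fin (D.F.P D.K).d) × oc) ι' Ω 𝒴)
          (opA_mem_measOp_slotsOfRecordShift D ιr cc ag sg Pm 𝒵 domZ Jc Vv mI Lsl hbdA hmQA hmRA)
          (opB_mem_measOp_slotsOfRecordShift D ιr cc ag sg Pm 𝒵 domZ Jc Vv mI Lsl hbdB hmQB hmRB))).histRef) ROp RHist) W)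
    (hexp : ActExpLinearOn (labelsIndexing (domainGeometry D.toTwoRuns) (b13InnerData D.toTwoRuns)) (restrict (slotsOfRecordShift D ιr cc ag sg Pm 𝒵 domZ Jc Vv mI Lsl) (measOp T ((Tor (unitMod (D.F.P D.K)) × Fin (D.F.P D.K).d) × oc) ι' Ω 𝒴)
          (opA_mem_measOp_slotsOfRecordShift D ιr cc ag sg Pm 𝒵 domZ Jc Vv mI Lsl hbdA hmQA hmRA)
          (opB_mem_measOp_slotsOfRecordShift D ιr cc ag sg Pm 𝒵 domZ Jc Vv mI Lsl hbdB hmQB hmRB)).act Dt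
      (ballClass (selfCtr (assemblyOn (restrict (slotsOfRecordShift D ιr cc ag sg Pm 𝒵 domZ Jc Vv mI Lsl) (measOp T ((Tor (unitMod (D.F.P D.K)) × Fin (D.F.P D.K).d) × oc) ι' Ω 𝒴)
          (opA_mem_measOp_slotsOfRecordShift D ιr cc ag sg Pm 𝒵 domZ Jc Vv mI Lsl hbdA hmQA hmRA)
          (opB_mem_measOp_slotsOfRecordShift D ιr cc ag sg Pm 𝒵 domZ Jc Vv mI Lsl hbdB hmQB hmRB))).raw
        (assemblyOn (restrict (slotsOfRecordShift D ιr cc ag sg Pm 𝒵 domZ Jc Vv mI Lsl) (measOp T ((Tor (unitMod (D.F.P D.K)) × Fin (D.F.P D.K).d) × oc) ι' Ω 𝒴)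
          (opA_mem_measOp_slotsOfRecordShift D ιr cc ag sg Pm 𝒵 domZ Jc Vv mI Lsl hbdA hmQA hmRA)
          (opB_mem_measOp_slotsOfRecordShift D ιr cc ag sg Pm 𝒵 domZ Jc Vv mI Lsl hbdB hmQB hmRB))).histRef) ROp RHist) W)
    (hE₀ : 0 ≤ E₀) (hcA : 0 ≤ cA) (hcB : 0 ≤ cB) (hr₀ : 0 < r₀) (hδ' : 0 ≤ δ')
    (hθθ' : Real.sqrt (max θ ((L : ℝ)⁻¹)) ≤ θ') (hθ'1 : θ' ≤ 1) (hω : 0 < Lsl.ins.ω) (hω1 : Lsl.ins.ω < 1)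
    (hh : cA * (EA₀ + E₀) < 1 - Lsl.ins.ω)
    (hsmall : Lsl.ins.ω + Φ' / (1 - 36 * Φ') * cA * (1 - Lsl.ins.ω) / (1 - Lsl.ins.ω - cA * (EA₀ + E₀)) < θ') :
    ∃ C₅, NE5 (B13StepOfRecord.outA (slotsOfRecordShift D ιr cc ag sg Pm 𝒵 domZ Jc Vv mI Lsl) E₀ cB) (B13StepOfRecord.outB (slotsOfRecordShift D ιr cc ag sg Pm 𝒵 domZ Jc Vv mI Lsl) E₀ cB) W κ θ' C₅ :=
  exists_ne5_of_substrateShift_restrict_envelope_actNormDecay D ιr cc ag sg Pm 𝒵 domZ Jc Vv mI Lsl E₀ cB hbdA hmQA hmRA hbdB hmQB hmRB iopAt hiopA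
    hbB hbA hdA hdB hRA hRB
    (weightedEntrywiseRate_slotsOfRecordShift_balaban_ne3Shape D ιr cc ag sg Pm 𝒵 domZ Jc Vv mI Lsl L M a ha hL hd hreg hα hβ hC hNE3 ha' hαη hβη
      hη hdec₁ hcovA hcovB hdom₁ hΦ hΛ₂ hS₂ hdecΦ hΔA hΔB hdom₂ hΨ hΛ₃ hS₃ hdecΨ hΓA hΓB hdom₃ hΛ₄ hΛ₅ hQ hR)
    hfl hins hOp hHist hA hA0 hA0' hκ hdec hΦ0 hΦsmall hΦ' hact hexp hE₀ hcA hcB (c1_balaban_nonneg L a hC hΛ₄ hΛ₅) hr₀ hδ'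
    (sqrt_rate_pos_lt_one L hL hNE3.rate_lt_one).1 (sqrt_rate_pos_lt_one L hL hNE3.rate_lt_one).2 hθθ' hθ'1 hω hω1 hh hsmall

end Instance

end Summit.QuantumFields.BalabanUV.T4Continuum.B13StepEnvelopeEndSubstrateShiftBalaban

end
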